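import Literature.Barriers.RiemannHypothesis.EpsteinZetaBatemanGrosswaldProofs
import Literature.Analysis.FunctionSpaces.BesselKMellin
import HarnessLib

/-!
# Bateman–Grosswald 1964, Theorem 1, the series `H(s)`: absolute convergence for every `s`, entirety, and `H(s) = H(1 − s)`

Sibling proof file of `Literature/Barriers/RiemannHypothesis/EpsteinZetaBatemanGrosswald.lean`
(no new definitions): the first three conjuncts of the named fact
`Literature.Barriers.RiemannHypothesis.BatemanGrosswald1964_thm1` (the Chowla–Selberg formula),
for the series
`H(s) = 4 Σ_{n ≥ 1} n^{s−½} σ_{1−2s}(n) cos(nπb/a) K_{s−½}(2πkn)` of (4) (`bgH`, `bgHTerm`):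

* `summable_bgHTerm_succ_of_isPosDefForm` — **the series (4) converges absolutely for every
  complex `s`** ("the sum in (4) converges uniformly in `B`" for bounded `B`, p. 370): on
  `‖s‖ ≤ R` the `n`-th term is `≤ C(R, k) n^{N(R)} e^{−2πkn}` (`norm_bgHTerm_le_of_norm_le`), by the
  uniform exponential decay `‖K_ν(x)‖ ≤ ½e^{a−x}M₀(a, R')` of
  `Literature/Analysis/FunctionSpaces/BesselKMellin.lean` and the trivial bounds
  `|n^{s−½}| = n^{σ−½}`, `|σ_ν(n)| ≤ n · n^{|Re ν|}`;
* `differentiable_bgH` — **`H` is entire**: each term is entire in `s` (`ν ↦ K_ν(x)` is entire,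
  `Literature.Analysis.FunctionSpaces.differentiable_besselK_left`) and the convergence is uniform on
  every disc (Mathlib `differentiableOn_tsum_of_summable_norm`);
* `bgH_one_sub` — **`H(1 − s) = H(s)`**, termwise: `K_{−ν} = K_ν` and
  `n^{s−½} σ_{1−2s}(n) = n^{½−s} σ_{2s−1}(n)` (`σ_ν(n) = n^ν σ_{−ν}(n)`, `d ↦ n/d`).

The fourth conjunct, the formula (3) itself, is proved in
`EpsteinZetaChowlaSelberg.lean` (via `EpsteinZetaChowlaSelbergLineSum.lean`).

## References

* [BatemanGrosswald1964] P. T. Bateman, E. Grosswald, *On Epstein's zeta function*, Acta Arith. 9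
  (1964) 365–373, Theorem 1 (3)–(4) and p. 370 (statement as quoted in the facts file's module
  docstring, transcribed there from the page images of the held scan `doi:10.4064/aa-9-4-365-373`).
-/

noncomputable section

open MeasureTheory Set Filter Topology

namespace Literature.Barriers.RiemannHypothesis

open Literature.Analysis.FunctionSpaces
open Literature.Analysis.Complex.Polya1926 (polyaM polyaM_nonneg)

variable {a b c : ℝ}

/-! ## The symmetry `s ↔ 1 − s` of the terms of (4) -/

/-- `(u/v)^ν = u^ν · v^{−ν}` for real `u ≥ 0`, `v > 0` and complex `ν`. [folklore] -/
theorem ofReal_div_cpow {u v : ℝ} (hu : 0 ≤ u) (hv : 0 < v) (ν : ℂ) :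
    ((u / v : ℝ) : ℂ) ^ ν = (u : ℂ) ^ ν * (v : ℂ) ^ (-ν) := by
  rw [div_eq_mul_inv, Complex.ofReal_mul, Complex.mul_cpow_ofReal_nonneg hu (inv_nonneg.2 hv.le),
    Complex.ofReal_inv, Complex.inv_cpow _ _ (by rw [Complex.arg_ofReal_of_nonneg hv.le]; exact
      Real.pi_pos.ne), Complex.cpow_neg]

/-- **`σ_ν(n) = n^ν σ_{−ν}(n)`**: `d ↦ n/d` permutes the divisors (both sides vanish at `n = 0`).
[folklore] -/
theorem sigmaC_eq_cpow_mul_sigmaC_neg (ν : ℂ) (n : ℕ) :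
    sigmaC ν n = (n : ℂ) ^ ν * sigmaC (-ν) n := by
  unfold sigmaC
  rw [Finset.mul_sum, ← Nat.sum_div_divisors n (fun d => ((d : ℕ) : ℂ) ^ ν)]
  refine Finset.sum_congr rfl fun d hd => ?_
  have hd0 : 0 < d := Nat.pos_of_mem_divisors hd
  have hdvd : d ∣ n := Nat.dvd_of_mem_divisors hd
  have e : (((n / d : ℕ) : ℕ) : ℂ) = (((n : ℝ) / (d : ℝ) : ℝ) : ℂ) := by
    push_cast
    rw [Nat.cast_div hdvd (by exact_mod_cast hd0.ne')]
  rw [e, ofReal_div_cpow (Nat.cast_nonneg n) (by exact_mod_cast hd0) ν]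
  push_cast
  ring

/-- `n^{s−½} σ_{1−2s}(n) = n^{½−s} σ_{2s−1}(n)` (`n ≥ 1`). [folklore] -/
theorem cpow_mul_sigmaC_one_sub (s : ℂ) {n : ℕ} (hn : 0 < n) :
    ((n : ℕ) : ℂ) ^ ((1 - s) - 1 / 2) * sigmaC (1 - 2 * (1 - s)) n =
      ((n : ℕ) : ℂ) ^ (s - 1 / 2) * sigmaC (1 - 2 * s) n := by
  have hn0 : ((n : ℕ) : ℂ) ≠ 0 := by exact_mod_cast hn.ne'
  rw [sigmaC_eq_cpow_mul_sigmaC_neg (1 - 2 * s) n, ← mul_assoc, ← Complex.cpow_add _ _ hn0]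
  congr 1
  · congr 1; ring
  · congr 1; ring

/-- The same symmetry written with `½ − s` and `2s − 1`:
`n^{½−s} σ_{2s−1}(n) = n^{s−½} σ_{1−2s}(n)` (`n ≥ 1`). [folklore] -/
theorem cpow_mul_sigmaC_symm (s : ℂ) {n : ℕ} (hn : 0 < n) :
    ((n : ℕ) : ℂ) ^ (1 / 2 - s) * sigmaC (2 * s - 1) n =
      ((n : ℕ) : ℂ) ^ (s - 1 / 2) * sigmaC (1 - 2 * s) n := by
  have h := cpow_mul_sigmaC_one_sub s hn
  rw [show (1 - s) - 1 / 2 = 1 / 2 - s by ring, show 1 - 2 * (1 - s) = 2 * s - 1 by ring] at h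
  exact h

/-- **The `n`-th term of (4) is symmetric under `s ↦ 1 − s`** (`n ≥ 1`): `K_{½−s} = K_{s−½}` and the
previous lemma. [cite: BatemanGrosswald1964, Theorem 1 (`H(s) = H(1 − s)`)] -/
theorem bgHTerm_one_sub (a b c : ℝ) (s : ℂ) {n : ℕ} (hn : 0 < n) :
    bgHTerm a b c (1 - s) n = bgHTerm a b c s n := by
  unfold bgHTerm
  rw [cpow_mul_sigmaC_one_sub s hn, show (1 - s) - 1 / 2 = -(s - 1 / 2) by ring, besselK_neg]

/-- **`H(1 − s) = H(s)`** for every `s` (and every real `a, b, c`), termwise.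
[cite: BatemanGrosswald1964, Theorem 1 (`H(s) = H(1 − s)`)] -/
theorem bgH_one_sub (a b c : ℝ) (s : ℂ) : bgH a b c (1 - s) = bgH a b c s := by
  unfold bgH
  congr 1
  exact tsum_congr fun n => bgHTerm_one_sub a b c s (Nat.succ_pos n)

/-! ## Uniform bounds for the terms of (4) -/

/-- `n^r ≤ n^N` for `n ≥ 1`, real `r ≤ N`, `N : ℕ`. [folklore] -/
theorem natCast_rpow_le_pow {n : ℕ} (hn : 0 < n) {r : ℝ} {N : ℕ} (h : r ≤ N) :
    (n : ℝ) ^ r ≤ (n : ℝ) ^ N := by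
  have h1 : (1 : ℝ) ≤ n := by exact_mod_cast hn
  calc (n : ℝ) ^ r ≤ (n : ℝ) ^ (N : ℝ) := Real.rpow_le_rpow_of_exponent_le h1 h
    _ = (n : ℝ) ^ N := Real.rpow_natCast _ _

/-- `|σ_ν(n)| ≤ n · n^N` when `|Re ν| ≤ N` (`n ≥ 1`; at most `n` divisors, each `d^{Re ν} ≤ n^N`).
[folklore] -/
theorem norm_sigmaC_le_mul_pow (ν : ℂ) {n : ℕ} (hn : 0 < n) {N : ℕ} (hN : |ν.re| ≤ N) :
    ‖sigmaC ν n‖ ≤ n * (n : ℝ) ^ N := by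
  refine (norm_sigmaC_le ν n).trans ?_
  have hterm : ∀ d ∈ n.divisors, (d : ℝ) ^ ν.re ≤ (n : ℝ) ^ N := by
    intro d hd
    have hd0 : 0 < d := Nat.pos_of_mem_divisors hd
    have hd1 : (1 : ℝ) ≤ d := by exact_mod_cast hd0
    have hdn : (d : ℝ) ≤ n := by exact_mod_cast Nat.divisor_le hd
    calc (d : ℝ) ^ ν.re ≤ (d : ℝ) ^ |ν.re| := Real.rpow_le_rpow_of_exponent_le hd1 (le_abs_self _)
      _ ≤ (n : ℝ) ^ |ν.re| := Real.rpow_le_rpow (by positivity) hdn (abs_nonneg _)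
      _ ≤ (n : ℝ) ^ N := natCast_rpow_le_pow hn hN
  calc ∑ d ∈ n.divisors, (d : ℝ) ^ ν.re ≤ ∑ d ∈ n.divisors, (n : ℝ) ^ N := Finset.sum_le_sum hterm
    _ = n.divisors.card * (n : ℝ) ^ N := by rw [Finset.sum_const, nsmul_eq_mul]
    _ ≤ n * (n : ℝ) ^ N := by
        gcongr
        exact_mod_cast Nat.card_divisors_le_self n

/-- The exponent `N(R) = ⌈R + ½⌉ + 1 + ⌈2R + 1⌉` of the polynomial factor in the uniform bound.
(An abbreviation inside statements only; not a definition of the theory.) [folklore] -/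
theorem natDeg_spec (R : ℝ) : R + 1 / 2 ≤ (⌈R + 1 / 2⌉₊ : ℝ) ∧ 2 * R + 1 ≤ (⌈2 * R + 1⌉₊ : ℝ) :=
  ⟨Nat.le_ceil _, Nat.le_ceil _⟩

/-- **Uniform bound for the terms of (4) on `‖s‖ ≤ R`**: for `n ≥ 1`,
`|n^{s−½} σ_{1−2s}(n) cos(nπb/a) K_{s−½}(2πkn)| ≤ (½ e^{2πk} M₀(2πk, R + ½)) · n^{N(R)} · e^{−2πkn}`,
`N(R) = ⌈R + ½⌉ + 1 + ⌈2R + 1⌉`, `M₀` Pólya's moment (`polyaM 0`).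
[cite: BatemanGrosswald1964, Theorem 1 (convergence of (4)), p. 370] -/
theorem norm_bgHTerm_le_of_norm_le (h : IsPosDefForm a b c) {R : ℝ} (hR : 0 ≤ R) {s : ℂ}
    (hs : ‖s‖ ≤ R) {n : ℕ} (hn : 0 < n) :
    ‖bgHTerm a b c s n‖ ≤
      (Real.exp (2 * Real.pi * starkK a b c) / 2 *
          polyaM 0 (2 * Real.pi * starkK a b c) ((R + 1 / 2 : ℝ) : ℂ)) *
        ((n : ℝ) ^ (⌈R + 1 / 2⌉₊ + 1 + ⌈2 * R + 1⌉₊) *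
          Real.exp (-(2 * Real.pi * starkK a b c) * n)) := by
  have hk : 0 < starkK a b c := starkK_pos h
  set κ := 2 * Real.pi * starkK a b c with hκ
  have hκ0 : 0 < κ := by positivity
  have hn1 : (1 : ℝ) ≤ n := by exact_mod_cast hn
  have hres : |s.re| ≤ R := (Complex.abs_re_le_norm s).trans hs
  obtain ⟨hc1, hc2⟩ := natDeg_spec R
  -- the four factors
  have e1 : ‖((n : ℕ) : ℂ) ^ (s - 1 / 2)‖ ≤ (n : ℝ) ^ ⌈R + 1 / 2⌉₊ := by
    rw [Complex.norm_natCast_cpow_of_pos hn]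
    refine natCast_rpow_le_pow hn ?_
    have : (s - 1 / 2).re = s.re - 1 / 2 := by simp
    rw [this]
    linarith [(abs_le.1 hres).2]
  have e2 : ‖sigmaC (1 - 2 * s) n‖ ≤ n * (n : ℝ) ^ ⌈2 * R + 1⌉₊ := by
    refine norm_sigmaC_le_mul_pow _ hn ?_
    have : (1 - 2 * s).re = 1 - 2 * s.re := by simp
    rw [this]
    refine le_trans ?_ hc2
    rw [abs_le]
    constructor <;> linarith [(abs_le.1 hres).1, (abs_le.1 hres).2]
  have e3 : ‖(Real.cos (n * Real.pi * b / a) : ℂ)‖ ≤ 1 := by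
    rw [Complex.norm_real, Real.norm_eq_abs]; exact Real.abs_cos_le_one _
  have e4 : ‖besselK (s - 1 / 2) ((2 * Real.pi * starkK a b c * n : ℝ) : ℂ)‖ ≤
      Real.exp (κ - κ * n) / 2 * polyaM 0 κ ((R + 1 / 2 : ℝ) : ℂ) := by
    have hax : κ ≤ κ * n := le_mul_of_one_le_right hκ0.le hn1
    have hν : ‖s - 1 / 2‖ ≤ R + 1 / 2 := by
      calc ‖s - 1 / 2‖ ≤ ‖s‖ + ‖(1 / 2 : ℂ)‖ := norm_sub_le _ _
        _ ≤ R + 1 / 2 := by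
            have : ‖(1 / 2 : ℂ)‖ = 1 / 2 := by norm_num
            rw [this]; linarith
    have := Literature.Analysis.FunctionSpaces.norm_besselK_le_of_norm_le hκ0 hax
      (by linarith : (0 : ℝ) ≤ R + 1 / 2) hν
    rw [show ((κ * n : ℝ) : ℂ) = ((2 * Real.pi * starkK a b c * n : ℝ) : ℂ) by rw [hκ]] at this
    exact this
  have hM : 0 ≤ polyaM 0 κ ((R + 1 / 2 : ℝ) : ℂ) := polyaM_nonneg _ _ _
  unfold bgHTerm
  rw [norm_mul, norm_mul, norm_mul]
  calc ‖((n : ℕ) : ℂ) ^ (s - 1 / 2)‖ * ‖sigmaC (1 - 2 * s) n‖ * ‖(Real.cos (n * Real.pi * b / a) : ℂ)‖ *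
        ‖besselK (s - 1 / 2) ((2 * Real.pi * starkK a b c * n : ℝ) : ℂ)‖
      ≤ (n : ℝ) ^ ⌈R + 1 / 2⌉₊ * (n * (n : ℝ) ^ ⌈2 * R + 1⌉₊) * 1 *
          (Real.exp (κ - κ * n) / 2 * polyaM 0 κ ((R + 1 / 2 : ℝ) : ℂ)) := by
        gcongr
    _ = (Real.exp κ / 2 * polyaM 0 κ ((R + 1 / 2 : ℝ) : ℂ)) *
          ((n : ℝ) ^ (⌈R + 1 / 2⌉₊ + 1 + ⌈2 * R + 1⌉₊) * Real.exp (-κ * n)) := by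
        rw [sub_eq_add_neg, Real.exp_add, pow_add, pow_add, pow_one, show -(κ * n) = -κ * n by ring]
        ring

/-- The majorant `n^N e^{−κn}` is summable (`κ > 0`), also after the shift `n ↦ n + 1`. [folklore] -/
theorem summable_pow_mul_exp_neg_succ (N : ℕ) {κ : ℝ} (hκ : 0 < κ) :
    Summable fun n : ℕ => (((n + 1 : ℕ) : ℝ) ^ N * Real.exp (-κ * ((n + 1 : ℕ) : ℝ))) :=
  (summable_nat_add_iff 1).2 (Real.summable_pow_mul_exp_neg_nat_mul N hκ)

/-- **Theorem 1, conjunct 1: the series (4) converges absolutely for every `s`.**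
[cite: BatemanGrosswald1964, Theorem 1 (convergence of (4)), p. 370] -/
theorem summable_bgHTerm_succ_of_isPosDefForm (h : IsPosDefForm a b c) (s : ℂ) :
    Summable fun n : ℕ => bgHTerm a b c s (n + 1) := by
  have hκ : 0 < 2 * Real.pi * starkK a b c := by have := starkK_pos h; positivity
  refine Summable.of_norm_bounded (g := fun n : ℕ =>
    (Real.exp (2 * Real.pi * starkK a b c) / 2 *
        polyaM 0 (2 * Real.pi * starkK a b c) ((‖s‖ + 1 / 2 : ℝ) : ℂ)) *
      ((((n + 1 : ℕ) : ℕ) : ℝ) ^ (⌈‖s‖ + 1 / 2⌉₊ + 1 + ⌈2 * ‖s‖ + 1⌉₊) *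
        Real.exp (-(2 * Real.pi * starkK a b c) * ((n + 1 : ℕ) : ℝ))))
    ((summable_pow_mul_exp_neg_succ _ hκ).mul_left _) fun n => ?_
  exact norm_bgHTerm_le_of_norm_le h (norm_nonneg s) le_rfl (Nat.succ_pos n)

/-! ## Entirety of `H` -/

/-- Each term of (4) is an entire function of `s` (`n ≥ 1`): `n^{s−½}`, the finite sum
`σ_{1−2s}(n) = Σ_{d∣n} d^{1−2s}` and `K_{s−½}(2πkn)` are entire
(`Literature.Analysis.FunctionSpaces.differentiable_besselK_left`). [folklore] -/
theorem differentiable_bgHTerm (h : IsPosDefForm a b c) {n : ℕ} (hn : 0 < n) :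
    Differentiable ℂ fun s : ℂ => bgHTerm a b c s n := by
  have hx : 0 < 2 * Real.pi * starkK a b c * n := by
    have := starkK_pos h
    have : (0 : ℝ) < n := by exact_mod_cast hn
    positivity
  have h1 : Differentiable ℂ fun s : ℂ => ((n : ℕ) : ℂ) ^ (s - 1 / 2) :=
    (differentiable_id.sub_const _).const_cpow (Or.inl (by exact_mod_cast hn.ne'))
  have h2 : Differentiable ℂ fun s : ℂ => sigmaC (1 - 2 * s) n := by
    unfold sigmaC
    refine Differentiable.fun_sum fun d hd => ?_
    have hd0 : ((d : ℕ) : ℂ) ≠ 0 := by exact_mod_cast (Nat.pos_of_mem_divisors hd).ne'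
    exact ((differentiable_const _).sub ((differentiable_const _).mul differentiable_id)).const_cpow
      (Or.inl hd0)
  have h4 : Differentiable ℂ fun s : ℂ =>
      besselK (s - 1 / 2) ((2 * Real.pi * starkK a b c * n : ℝ) : ℂ) :=
    (differentiable_besselK_left hx).comp (differentiable_id.sub_const _)
  unfold bgHTerm
  exact ((h1.mul h2).mul (differentiable_const _)).mul h4

/-- The series (4) is holomorphic on every disc `‖s‖ < R` (uniform convergence from
`norm_bgHTerm_le_of_norm_le`, Mathlib `differentiableOn_tsum_of_summable_norm`). [folklore] -/
theorem differentiableOn_tsum_bgHTerm (h : IsPosDefForm a b c) {R : ℝ} (hR : 0 ≤ R) :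
    DifferentiableOn ℂ (fun s : ℂ => ∑' n : ℕ, bgHTerm a b c s (n + 1)) (Metric.ball 0 R) := by
  have hκ : 0 < 2 * Real.pi * starkK a b c := by have := starkK_pos h; positivity
  refine Complex.differentiableOn_tsum_of_summable_norm (u := fun n : ℕ =>
    (Real.exp (2 * Real.pi * starkK a b c) / 2 *
        polyaM 0 (2 * Real.pi * starkK a b c) ((R + 1 / 2 : ℝ) : ℂ)) *
      ((((n + 1 : ℕ) : ℕ) : ℝ) ^ (⌈R + 1 / 2⌉₊ + 1 + ⌈2 * R + 1⌉₊) *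
        Real.exp (-(2 * Real.pi * starkK a b c) * ((n + 1 : ℕ) : ℝ))))
    ((summable_pow_mul_exp_neg_succ _ hκ).mul_left _)
    (fun n => (differentiable_bgHTerm h (Nat.succ_pos n)).differentiableOn) Metric.isOpen_ball
    fun n s hs => ?_
  exact norm_bgHTerm_le_of_norm_le h hR (le_of_lt (by simpa using hs)) (Nat.succ_pos n)

/-- **Theorem 1, conjunct 2: `H` is an entire function of `s`.**
[cite: BatemanGrosswald1964, Theorem 1 (`H(s)` is entire)] -/
theorem differentiable_bgH (h : IsPosDefForm a b c) : Differentiable ℂ (bgH a b c) := by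
  intro s
  have hmem : s ∈ Metric.ball (0 : ℂ) (‖s‖ + 1) := by simp
  have hd := (differentiableOn_tsum_bgHTerm h (by positivity : (0 : ℝ) ≤ ‖s‖ + 1)).differentiableAt
    (Metric.isOpen_ball.mem_nhds hmem)
  unfold bgH
  exact (differentiableAt_const _).mul hd

/-- The first three conjuncts of `BatemanGrosswald1964_thm1`, bundled. [cite: BatemanGrosswald1964, Theorem 1] -/
theorem BatemanGrosswald1964_thm1_series (h : IsPosDefForm a b c) :
    (∀ s : ℂ, Summable fun n : ℕ => bgHTerm a b c s (n + 1)) ∧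
    Differentiable ℂ (bgH a b c) ∧
    (∀ s : ℂ, bgH a b c s = bgH a b c (1 - s)) :=
  ⟨summable_bgHTerm_succ_of_isPosDefForm h, differentiable_bgH h, fun s => (bgH_one_sub a b c s).symm⟩

end Literature.Barriers.RiemannHypothesis
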